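import Literature.Geometry.Lorentzian.KerrWaveEnergy
import Literature.Geometry.Lorentzian.Sweep2
import HarnessLib

/-!
# Decay of scalar waves on subextremal Kerr: the Dafermos–Rodnianski–Shlapentokh-Rothman chain
(family `gr`, statement group **gr.S24**; trunk G08 = T-LORENTZ; namespace `Literature.GR`, glue in
`Literature.Lorentz.Kerr`)

`BlackHoles.lean` vendors three named facts about solutions of `□_g ψ = 0` on the subextremal
Kerr exterior `Kerr.exterior M a = {r > r₊}`, `|a| < M` (Dafermos–Rodnianski–Shlapentokh-Rothman,
*Decay for solutions of the wave equation on Kerr exterior spacetimes III*, arXiv:1402.7034 =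
Ann. of Math. 183 (2016); "DRSR" below): `drsr_wave_boundedness_kerr` (Thm. 3.1, estimate (23)),
`drsr_wave_polynomial_decay_kerr` (Cor. 3.1, energy flux `≤ C E τ⁻²`, local consequence) and the
qualitative `drsr_wave_local_energy_decay_kerr`, the latter *proved* there from the former.
This file records the next layer of the printed chain of results, in the same **consequence
form** (coordinate energies through the Kerr–Schild leaves `{t* = τ} ∩ {r > r₊}` of
`WeightedNorms.lean` / `Sweep2.lean`, admissible waves `IsAdmissibleKerrWave`), and proves the
implications between the vendored statements that hold at the level of the statements:

* `drsr_wave_integrated_decay_kerr` — **integrated local energy decay** (DRSR Thm. 3.2,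
  estimate (25) with `j = 2`, whose second line is non-degenerate at first order: trapping costs
  exactly one derivative), local consequence: `∫₀^∞ E_loc(τ, R) dτ ≤ C(M, a, R) · E₂[ψ](0)` with
  `E₂` the second-order coordinate energy of the data (`sliceSobolevEnergy … 0 2 0 univ`) and a
  constant **uniform in `ψ`** (named fact);
* `drsr_wave_pointwise_decay_kerr` — **pointwise decay** (DRSR Cor. 3.1, estimate (30)):
  `|ψ| ≤ C τ^{-3/2+δ}` on `{t* = τ} ∩ {r > r₊} ∩ {‖y‖ ≤ R}`, `τ ≥ 1`, every `δ > 0`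
  (named fact; `ψ_∞ = 0` for compactly supported data);
* `drsr_wave_derivative_decay_kerr` — **pointwise decay of first derivatives** (DRSR Cor. 3.1,
  estimate (31)): `∑_μ (∂_μ ψ)² ≤ C τ^{-4+2δ}` on the same sets (named fact);
* proved: `drsr_wave_polynomial_decay_kerr_of_derivative_decay` ((31) ⟹ the vendored local
  energy bound of `BlackHoles.lean`, by integrating the pointwise bound over the coordinate ball,
  with `δ = 1`), hence `drsr_wave_local_energy_decay_kerr_of_derivative_decay`;
  `drsr_wave_pointwise_decay_kerr.tendsto_zero` (`ψ(τ, y) → 0` as `τ → ∞` at every spatial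
  point); `drsr_wave_integrated_decay_kerr.frequently_lt` (finite `E₂` ⟹ the local energy dips
  below every `ε > 0` at arbitrarily late times — the qualitative content of integrated decay);
  `IsAdmissibleKerrWave.exists_eq_zero_of_lt_spatialNorm` (support propagation for admissible
  waves from the finite-speed-of-propagation fact of `KerrWaveEnergy.lean` — step (i) of the
  justification in *Design choices*).

## The printed chain (DRSR §3.4, "the logic of the proof") and what is vendored where

DRSR prove, for `|a| ≤ a₀ < M` and sufficiently regular `ψ` with `□_{g_{a,M}} ψ = 0` on
`𝓡₀ = D⁺(Σ₀)`: Thm. 3.1 ((20) degenerate integrated decay, (21) horizon flux, (22) null-infinity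
flux, (23) boundedness) and its higher-order version Thm. 3.2 ((25)–(28)); both transfer to any
admissible hypersurface `Σ̃₀` of the first or second kind in place of `Σ₀` (p. 14, by Prop. 4.6.1
of Dafermos–Rodnianski, arXiv:1010.5132), and Cor. 3.1 (energy flux `≤ C E τ⁻²` through a
hyperboloidal foliation, (30), (31)) then follows from the `r^p` "black box" of
Dafermos–Rodnianski (XVIth ICMP (2010) = arXiv:0910.4957; detailed in Moschidis, Ann. PDE 2
(2016)). Thms. 3.1–3.2 themselves rest on: well-posedness and reduction to smooth compactly
supported data (§4.1), the red-shift vector field `N` (Prop. 4.5.1), Carter's separation for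
"sufficiently integrable" functions (§5), the frequency-localised ODE estimates of §§6–8
culminating in Thm. 8.1, summation and the quantitative mode stability of Shlapentokh-Rothman
(Ann. Henri Poincaré 16 (2015) = arXiv:1302.3448; DRSR Prop. 9.7.1) giving Prop. 9.1.1
(integrated decay) and Prop. 10.1 (higher order) for *future-integrable* solutions, the
continuity argument in `a` of §11 (Prop. 11.1 via Props. 11.1.2, 11.2.1, 11.3.1: all solutions
with smooth compactly supported data are future-integrable), and the a-posteriori boundedness
argument of §13 (Prop. 13.1). None of these layers is formalised; the Lean dependency graph
recorded here is

  `drsr_wave_local_energy_decay_kerr` ⟸ `drsr_wave_polynomial_decay_kerr` (proved in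
  `BlackHoles.lean`) ⟸ `drsr_wave_derivative_decay_kerr` (proved here) = Cor. 3.1 (31)
  ⟸ {Thm. 3.1, Thm. 3.2 (`drsr_wave_boundedness_kerr`, `drsr_wave_integrated_decay_kerr` are
  their vendored local consequences), `r^p` method} — the last arrow is not expressible with the
  present prelude (no hyperboloidal leaves, `J^N`-fluxes or `r^p` boundary terms on the Kerr
  chart) and is documented only.

## Design choices

* **Consequence form and the two foliations.** DRSR's leaves `Σ_τ = {t* = τ}` use the Kerr-star time
  `t* = t + t̄(r)` of §2.1.3 (p. 10): `t̄(r) = r*(r) − r + const` for `r ≤ 15M/8` and `t̄(r) = 0`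
  for `r ≥ 9M/4`, so that away from the black hole `Σ_τ` is the Boyer–Lindquist slice `{t = τ}`. The
  prelude's time is the ingoing Kerr–Schild time `t*_KS = t + r*(r) − r + const` for **all** `r`
  (`dt*_KS = dt + (2Mr/Δ) dr`, `g(∇t*_KS, ∇t*_KS) = −1 − 2H`, `H = Mr/ρ²`): hence `t*_KS − t*` is
  constant on `{r ≤ 15M/8}`, bounded on every `{r ≤ R}`, and grows like `2M log r` at spatial
  infinity. The Kerr–Schild leaves `{t*_KS = τ} ∩ {r > r₊}` are uniformly spacelike, cross `𝓗⁺` and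
  are asymptotically flat, but they bend logarithmically to the past of `Σ_τ` and are therefore
  **not** admissible hypersurfaces of the first kind in the sense of Dafermos–Rodnianski
  (arXiv:1010.5132, §4.4, Def. 4.1 (iii): `Σ ∩ {y* ≥ y*_ε} ⊂ ⋃_{|τ'| ≤ ε} φ_{τ₀+τ'}(Σ₁)`); the
  module docstring of `KerrWaveEnergy.lean` makes the resulting reduction explicit for the
  boundedness statement (23). In both foliations `T = ∂_{t*} = ∂_{t*_KS}` is the stationary Killing
  field and `φ_τ` its flow. The facts of this file are **local** statements (`{‖y‖ ≤ R}`, and `r ≤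
  ‖y‖` by `Kerr.radius_le_spatialNorm`, proved, so `{‖y‖ ≤ R} ⊆ {r ≤ R}`) along `t*_KS → ∞`, for
  admissible waves `ψ` (`IsAdmissibleKerrWave`: smooth solutions of `□_g ψ = 0` on the whole
  exterior chart whose data are compactly supported in the open leaf `{t*_KS = 0, r > r₊}`), and for
  these the printed estimates apply after a time translation: (i) by finite speed of propagation in
  the ingoing chart, in which the coordinate speed of light is at most `1`
  (`kerr_finite_speed_of_propagation` of `KerrWaveEnergy.lean`), `supp ψ ∩ {0 ≤ t*_KS ≤ s} ⊆ {‖y‖ ≤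
  ρ + s}` if the data are supported in `{‖y‖ ≤ ρ}`; (ii) `t* ≤ t*_KS + c₀(M, a)` everywhere, so the
  leaf `{t*_KS = 0}` lies in the past of `φ_c(Σ₀) = {t* = c} ⊆ {t*_KS ≥ 0}`, `c = c₀(M, a)`, along
  which `t*_KS = c + O(log r)`; by (i) the data induced by `ψ` on `φ_c(Σ₀)` are supported in `{r ≤
  r₁(M, a, ρ)}`, and they are smooth up to `𝓗⁺` since `ψ` extends smoothly across `𝓗⁺ ∩ {t*_KS ≥ 0}`
  (solve the Cauchy problem on the Kerr–Schild chart continued a little inside the black hole from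
  the data extended by zero, Bär–Ginoux–Pfäffle 2007, Ch. 3; `{t*_KS ≥ 0, r > r₊} ⊆ D⁺({t*_KS = 0, r
  > r₊})` gives uniqueness there, and uniqueness in `D⁺(φ_c(Σ₀))`, arXiv:1010.5132, Prop. 4.5.1,
  identifies the restriction with DRSR's solution). Thus `ψ` restricted to `D⁺(φ_c(Σ₀))` is a
  solution arising from smooth compactly supported data on `φ_c(Σ₀)` — DRSR's class (§4.1) up to the
  time translation `φ_c` — with `ψ_∞ = 0` and every higher-order weighted energy `E` of Cor. 3.1
  ("on `Σ̃₀`, or alternatively on an asymptotically flat `Σ₀` in the past of `Σ̃₀`") finite. (iii)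
  On `{r₊ < r ≤ R₁}` a Kerr–Schild leaf point with `t*_KS = σ` lies on `Σ_{τ}` and on the
  hyperboloidal leaf `Σ̃_τ` of Cor. 3.1 (chosen to agree with `Σ_τ` on `{r ≤ R₁}`, DRSR p. 51) with
  `|τ − σ| ≤ C(M, a, R₁)`, so suprema over `Σ̃_τ ∩ {r ≤ R₁}`, `τ ≥ 1`, bound suprema over `{t*_KS =
  σ} ∩ {r ≤ R₁}` for `σ` large, with `τ^{-p} ≤ C σ^{-p}`; bounded ranges of `σ ≥ 1` are absorbed
  into the `ψ`-dependent constants (`ψ` is smooth up to `𝓗⁺`). (iv) On `{t*_KS = σ} ∩ {r₊ < r ≤ R₁}`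
  the frame `(T, Z*, ∇̸)` of (25), the normal/tangential derivatives `(n_Σ̃ ψ, ∇_Σ̃ ψ)` of (31) and
  the `J^N · n` density are each comparable to the coordinate gradient `∑_μ (∂_μ ψ)²` with constants
  depending only on `(M, a, R₁)` (`φ_τ`-invariance and smoothness up to `𝓗⁺`), and the Kerr–Schild
  coordinate volume `dt*_KS d³y` *is* the metric volume (`det g = −1` for `g = η + 2H ℓ ⊗ ℓ`, `ℓ`
  null). (v) For the one fact with a constant uniform in `ψ` (`drsr_wave_integrated_decay_kerr`),
  the right-hand side of (25) on `φ_c(Σ₀)`, `∫ (J^N[ψ] + J^N[Nψ]) · n`, is bounded by `C(M, a)`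
  times the second-order coordinate energy of the data on `{t*_KS = 0}`: in the far region, where
  `T` is timelike (`Kerr.two_mul_scalarH_le_half`) and `N = T`, by the `J^T` energy identity for `ψ`
  and `Tψ` between the two hypersurfaces (`K^T = 0`; the argument of arXiv:1010.5132, Prop. 4.6.1,
  vendored for graphs as `kerr_far_TEnergy_comparison` in `KerrWaveEnergy.lean`), and in the compact
  near region, where the two foliations differ by a bounded time translation, by the finite-in-time
  energy estimate; the contribution of the slab `{0 ≤ t*_KS} ∩ {t* ≤ c} ∩ {‖y‖ ≤ R}` (of
  `t*_KS`-width `≤ c + C(M, a, R)`) to `∫₀^∞ E_loc dτ` is bounded by uniform boundedness (23)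
  (`drsr_wave_boundedness_kerr`). With these standard identifications each vendored `Prop` is
  implied by the printed estimate it cites, with `a₀ := |a|`; none is stronger. (Outside this bullet
  an unsubscripted `t*` in this file is the prelude's Kerr–Schild time `t*_KS`, except inside
  quotations from DRSR, where it is their Kerr-star time.)
* **Constants.** In the integrated-decay fact the constant is uniform in `ψ` (as printed, `C(a₀, M,
  δ, j)` with `δ := 1`, `j := 2`, and the locality radius `R`), multiplying the explicit
  second-order initial energy `sliceSobolevEnergy (Kerr.exterior M a) ψ 0 2 0 univ` (`∫_{t*_KS=0}
  ∑_{m ≤ 2} ‖D^m ψ̃‖² dy`, which dominates `∫ (J^N[ψ] + J^N[Nψ]) · n` through the Kerr–Schild leaf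
  `{t*_KS = 0}` since `N` is smooth, `φ_τ`-invariant and equal to `T` for large `r`, Prop. 4.5.1,
  and hence, by (v) above, the right-hand side of (25) on `φ_c(Σ₀)`). In the two pointwise facts the
  printed right-hand sides are `C(a₀, M, δ, R) √E τ^{-3/2+δ}` and `C(a₀, M, δ, R) E τ^{-2+δ}` with
  `E` "an appropriate higher order weighted energy"; as in `drsr_wave_polynomial_decay_kerr` we
  existentially quantify one real constant depending on `(M, a, δ, R, ψ)`, which loses the
  (unspecified) dependence on `ψ` but nothing else.
* **Points of a leaf** are written `E4.ofTimeSpace τ y`, `y : E3`, exactly as in the integrands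
  of `sliceEnergy`/`localSliceEnergy`; membership `E4.ofTimeSpace τ y ∈ Kerr.exterior M a` does not
  depend on `τ` (`Kerr.radius_ofTimeSpace`, the Kerr–Schild radius is a function of the spatial
  part), whence the `y ∈ Kerr.slice a r₊` form in `tendsto_zero`.
* Imports: `KerrWaveEnergy` (which re-exports `BlackHoles` — the gr.S24 facts and
  `IsAdmissibleKerrWave` — and provides the Kerr–Schild bookkeeping lemmas
  `Kerr.radius_ofTimeSpace`, `Kerr.ofTimeSpace_mem_exterior_iff` and the named facts
  `kerr_finite_speed_of_propagation`, `kerr_far_TEnergy_comparison` referred to above) and `Sweep2`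
  (only for the higher-order coordinate energy `sliceSobolevEnergy`, a promotion candidate for
  `WeightedNorms`).

## References

* M. Dafermos, I. Rodnianski, Y. Shlapentokh-Rothman, *Decay for solutions of the wave equation
  on Kerr exterior spacetimes III: the full subextremal case `|a| < M`*, Ann. of Math. 183 (2016)
  787–913, arXiv:1402.7034: §2.2.5, §3 (Thm. 3.1 (20)–(23), Thm. 3.2 (25)–(28), Cor. 3.1 (30)–(31),
  §3.4), §4.1, Prop. 4.5.1, Thm. 8.1, Props. 9.1.1, 9.7.1, 10.1, 11.1, 13.1
  (key `DafermosRodnianskiShlapentokhrothman2014`).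
* M. Dafermos, I. Rodnianski, *A new physical-space approach to decay for the wave equation with
  applications to black hole spacetimes*, XVIth ICMP, World Scientific (2010) 421–432,
  arXiv:0910.4957 (key `DafermosRodnianski2010ICMP`); G. Moschidis, *The `r^p`-weighted energy
  method of Dafermos and Rodnianski in general asymptotically flat spacetimes and applications*,
  Ann. PDE 2 (2016) 6, arXiv:1509.08489 (key `Moschidis2016`).
* M. Dafermos, I. Rodnianski, *Decay for solutions of the wave equation on Kerr exterior
  spacetimes I–II: the cases `|a| ≪ M` or axisymmetry*, arXiv:1010.5132, Props. 4.5.1, 4.6.1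
  (key `DafermosRodnianski2010KerrSmallA`); *Lectures on black holes and linear waves*,
  arXiv:0811.0354, §4–§5 (key `DafermosRodnianski2008`).
* C. Bär, N. Ginoux, F. Pfäffle, *Wave equations on Lorentzian manifolds and quantization*, EMS
  (2007), arXiv:0806.1036, Ch. 3 (the Cauchy problem on globally hyperbolic manifolds)
  (key `BarGinouxPfaffle2007`).
* Y. Shlapentokh-Rothman, *Quantitative mode stability for the wave equation on the Kerr
  spacetime*, Ann. Henri Poincaré 16 (2015) 289–345, arXiv:1302.3448
  (key `ShlapentokhRothman2015ModeStability`).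
-/

noncomputable section

open Set Filter MeasureTheory TopologicalSpace Metric
open scoped Topology ENNReal Manifold ContDiff

namespace Literature.Geometry.Lorentzian.Kerr

/-- `r ≤ ‖x⃗‖`: the Kerr–Schild radius is at most the Euclidean spatial radius (from the
defining quartic `r⁴ − (‖x⃗‖² − a²) r² − a² x₃² = 0` and `x₃² ≤ ‖x⃗‖²`:
`r² (r² − ‖x⃗‖²) = a² (x₃² − r²) ≤ a² (‖x⃗‖² − r²)`; equivalently `r² = ‖x⃗‖² − a² sin²θ`,
Visser arXiv:0706.0622, (35)). Hence the coordinate balls `{‖y‖ ≤ R}` of the local energies of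
`WeightedNorms` lie in the sets `{r ≤ R}` of the printed local estimates. [folklore] -/
theorem radius_le_spatialNorm (a : ℝ) (x : E4) : radius a x ≤ E4.spatialNorm x := by
  have hq := radius_quartic a x
  have hr := radius_nonneg a x
  have hρ := E4.spatialNorm_nonneg x
  have hz : x 3 ^ 2 ≤ E4.spatialNorm x ^ 2 := by
    rw [E4.spatialNorm_sq]; nlinarith [sq_nonneg (x 1), sq_nonneg (x 2)]
  by_contra h
  push Not at h
  have h1 : E4.spatialNorm x ^ 2 < radius a x ^ 2 := by nlinarith
  have h2 : radius a x ^ 2 * (radius a x ^ 2 - E4.spatialNorm x ^ 2) ≤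
      a ^ 2 * (E4.spatialNorm x ^ 2 - radius a x ^ 2) := by nlinarith [sq_nonneg a]
  nlinarith [sq_nonneg a, mul_pos (lt_of_le_of_lt (sq_nonneg _) h1) (sub_pos.2 h1)]

/-- `r(t, y) ≤ ‖y‖` on the leaf `{t* = t}` (coordinate form of `radius_le_spatialNorm`; Visser
arXiv:0706.0622, (35)). [folklore] -/
theorem radius_ofTimeSpace_le_norm (a t : ℝ) (y : E3) : radius a (E4.ofTimeSpace t y) ≤ ‖y‖ := by
  simpa [E4.spatialNorm_ofTimeSpace] using radius_le_spatialNorm a (E4.ofTimeSpace t y)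

end Literature.Geometry.Lorentzian.Kerr

namespace Literature.Geometry.Lorentzian


/-! ### Integrated local energy decay (DRSR Thm. 3.2, (25) with `j = 2`) -/

/-- **gr.S24** (integrated local energy decay on subextremal Kerr; Dafermos–Rodnianski–
Shlapentokh-Rothman, arXiv:1402.7034 = Ann. of Math. 183 (2016), Thm. 3.2, estimate (25)). As
printed: for `M > 0`, `0 ≤ a₀ < M`, all `δ > 0` and integers `j ≥ 1` there is
`C = C(a₀, M, δ, j)` such that for `|a| ≤ a₀` and all sufficiently regular solutions of
`□_{g_{a,M}} ψ = 0` on `𝓡₀`,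
`∫_{𝓡₀} r^{-1-δ} ζ ∑_{1≤i₁+i₂+i₃≤j} |∇̸^{i₁}T^{i₂}(Z̃*)^{i₃}ψ|²
  + r^{-1-δ} ∑_{1≤i₁+i₂+i₃≤j-1} (|∇̸^{i₁}T^{i₂}(Z̃*)^{i₃+1}ψ|² + |∇̸^{i₁}T^{i₂}(Z*)^{i₃}ψ|²)
  ≤ C ∫_{Σ₀} ∑_{0≤i≤j-1} J^N_μ[N^i ψ] n^μ_{Σ₀}` (25),
where `ζ` degenerates at trapping (§2.2.3) but the second sum does not; for `j = 2` its terms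
`|∇̸ψ|² + |Tψ|² + |Z*ψ|²` control the full first-order gradient (trapping costs one derivative).
Vendored local consequence (module docstring, *Design choices*): for `|a| < M` and every
coordinate radius `R` there is a constant `C = C(M, a, R) < ∞`, **uniform in `ψ`**, such that
for every admissible wave `ψ` (`IsAdmissibleKerrWave`) the local coordinate energy
`E_loc(τ, R) = localSliceEnergy ψ τ R` through `{t* = τ} ∩ {r > r₊} ∩ {‖y‖ ≤ R}` satisfies
`∫₀^∞ E_loc(τ, R) dτ ≤ C · E₂[ψ](0)`, `E₂[ψ](0) = sliceSobolevEnergy (Kerr.exterior M a) ψ 0 2 0 univ`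
the second-order coordinate energy of the data (which dominates the right-hand side of (25) for
`j = 2` by Prop. 4.5.1, the elliptic relation (29) and the energy comparison (v) of the module
docstring); `δ := 1`, `a₀ := |a|`, Fubini in `(t*_KS, y)` (the Kerr–Schild coordinate volume is
the metric volume) and `{‖y‖ ≤ R} ⊆ {r ≤ R}`.
Instance hypotheses `[Kerr.Facts] [Kerr.SliceFacts]` supply the Kerr metric and its Levi-Civita
connection. [cite: DafermosRodnianskiShlapentokhrothman2014, Thm. 3.2 (25)] -/
def drsr_wave_integrated_decay_kerr : Prop :=
  ∀ [Kerr.Facts] [Kerr.SliceFacts] (M a : ℝ), Kerr.IsSubextremal M a → ∀ R : ℝ,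
    ∃ C : ℝ≥0∞, C < ⊤ ∧ ∀ ψ : Kerr.exterior M a → ℝ, IsAdmissibleKerrWave M a ψ →
      ∫⁻ τ in Ioi (0 : ℝ), localSliceEnergy (Kerr.exterior M a) ψ τ R ≤
        C * sliceSobolevEnergy (Kerr.exterior M a) ψ 0 2 0 univ

/-! ### Pointwise decay (DRSR Cor. 3.1, (30) and (31)) -/

/-- **gr.S24** (pointwise decay on subextremal Kerr; Dafermos–Rodnianski–Shlapentokh-Rothman,
arXiv:1402.7034 = Ann. of Math. 183 (2016), Cor. 3.1, estimate (30)). As printed: for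
`a₀, M, a, δ` as in Thms. 3.1–3.2, `R > r₊`, `Σ̃₀` asymptotically hyperboloidal and
`Σ̃_τ = φ_τ(Σ̃₀)`, sufficiently regular solutions satisfy
`sup_{Σ̃_τ ∩ {r ≤ R}} |ψ − ψ_∞| ≤ C(a₀, M, δ, R) √E τ^{-3/2+δ}` (30), `E` an appropriate
higher-order weighted energy on `Σ̃₀` (or on an asymptotically flat `Σ₀` in its past),
`4π ψ_∞² = lim_{r'→∞} ∫_{Σ₀ ∩ {r = r'}} r⁻² ψ²`. Vendored consequence: for `|a| < M`, every
admissible wave `ψ` (`IsAdmissibleKerrWave`; then `ψ_∞ = 0` and `E < ∞`), every `δ > 0` and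
every coordinate radius `R` admit a real constant `C = C(M, a, δ, R, ψ)` with
`|ψ(τ, y)| ≤ C τ^{-3/2+δ}` for all `τ ≥ 1` and all `y` with `(τ, y) ∈ {r > r₊}`, `‖y‖ ≤ R`
(module docstring, (i)–(iii): the hyperboloidal `Σ̃₀` may be chosen to agree with DRSR's `Σ₀` on
`{r ≤ R₁}`, `R₁ = max(R, r₊ + 1)`, DRSR p. 51, and the Kerr–Schild leaf portions
`{t*_KS = σ} ∩ {‖y‖ ≤ R} ⊆ {t*_KS = σ} ∩ {r ≤ R₁}` lie on leaves `Σ̃_τ` with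
`|τ − σ| ≤ C(M, a, R₁)`). [cite: DafermosRodnianskiShlapentokhrothman2014, Cor. 3.1 (30)] -/
def drsr_wave_pointwise_decay_kerr : Prop :=
  ∀ [Kerr.Facts] [Kerr.SliceFacts] (M a : ℝ), Kerr.IsSubextremal M a →
    ∀ ψ : Kerr.exterior M a → ℝ, IsAdmissibleKerrWave M a ψ → ∀ δ : ℝ, 0 < δ → ∀ R : ℝ,
      ∃ C : ℝ, ∀ τ : ℝ, 1 ≤ τ → ∀ (y : E3) (hy : E4.ofTimeSpace τ y ∈ Kerr.exterior M a),
        ‖y‖ ≤ R → |ψ ⟨E4.ofTimeSpace τ y, hy⟩| ≤ C * τ ^ (-(3 / 2 : ℝ) + δ)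

/-- **gr.S24** (pointwise decay of first derivatives on subextremal Kerr; Dafermos–Rodnianski–
Shlapentokh-Rothman, arXiv:1402.7034 = Ann. of Math. 183 (2016), Cor. 3.1, estimate (31)). As
printed: with the notation of (30),
`sup_{Σ̃_τ ∩ {r ≤ R}} |n_{Σ̃} ψ| + |∇_{Σ̃} ψ| ≤ C(a₀, M, δ, R) E τ^{-2+δ}` (31).
Vendored consequence: for `|a| < M`, every admissible wave `ψ`, every `δ > 0` and every
coordinate radius `R` admit a real constant `C = C(M, a, δ, R, ψ)` such that the coordinate
energy density `coordEnergyDensity ψ (τ, y) = ∑_{μ=0}^{3} (∂_μ ψ)²(τ, y)` (`WeightedNorms.lean`)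
is at most `C τ^{-4+2δ}` for all `τ ≥ 1` and all `y` with `(τ, y) ∈ {r > r₊}`, `‖y‖ ≤ R`: at a
point of `{t*_KS = σ} ∩ {r₊ < r ≤ R₁}` the normal and tangential derivatives to the (uniformly
spacelike, `φ_τ`-invariant) hyperboloidal leaf `Σ̃_τ` through it, `|τ − σ| ≤ C(M, a, R₁)`, bound
the coordinate gradient with a constant depending on `(M, a, R₁)`, and the square of (31) is
taken (module docstring, (i)–(iv)). This fact implies the vendored energy
decay statements of `BlackHoles.lean` (`drsr_wave_polynomial_decay_kerr_of_derivative_decay`). [cite: DafermosRodnianskiShlapentokhrothman2014, Cor. 3.1 (31)] -/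
def drsr_wave_derivative_decay_kerr : Prop :=
  ∀ [Kerr.Facts] [Kerr.SliceFacts] (M a : ℝ), Kerr.IsSubextremal M a →
    ∀ ψ : Kerr.exterior M a → ℝ, IsAdmissibleKerrWave M a ψ → ∀ δ : ℝ, 0 < δ → ∀ R : ℝ,
      ∃ C : ℝ, ∀ τ : ℝ, 1 ≤ τ → ∀ y : E3, E4.ofTimeSpace τ y ∈ Kerr.exterior M a →
        ‖y‖ ≤ R → coordEnergyDensity (Kerr.exterior M a) ψ (E4.ofTimeSpace τ y) ≤
          C * τ ^ (-4 + 2 * δ)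

/-! ### Implications between the vendored statements -/

/-- **Support propagation for admissible waves** (step (i) of the module docstring). Under finite
speed of propagation in the ingoing chart (`kerr_finite_speed_of_propagation` of
`KerrWaveEnergy.lean`), an admissible wave — whose data on the leaf `{t*_KS = 0} ∩ {r > r₊}` are
supported in a compact set, hence in `{‖x⃗‖ ≤ ρ}` for some `ρ ≥ 0`
(`exists_spatialNorm_le_of_isCompact`) — vanishes together with its differential at every
exterior point with `t*_KS ≥ 0` and `‖x⃗‖ > ρ + t*_KS`. In particular its restriction to any
hypersurface in `{t*_KS ≥ 0}` along which `t*_KS = O(log ‖x⃗‖)` (a Dafermos–Rodnianski–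
Shlapentokh-Rothman slice `φ_c(Σ₀)`, arXiv:1402.7034, §2.1.3, §2.2.5) has compact support.
[folklore] -/
theorem IsAdmissibleKerrWave.exists_eq_zero_of_lt_spatialNorm
    (hfs : kerr_finite_speed_of_propagation) [Kerr.Facts] [Kerr.SliceFacts] {M a : ℝ}
    (hMa : Kerr.IsSubextremal M a) {ψ : Kerr.exterior M a → ℝ}
    (hψ : IsAdmissibleKerrWave M a ψ) :
    ∃ ρ : ℝ, 0 ≤ ρ ∧ ∀ x : Kerr.exterior M a, 0 ≤ (x : E4) 0 →
      ρ + (x : E4) 0 < E4.spatialNorm (x : E4) → ψ x = 0 ∧ mfderiv 𝓘(ℝ, E4) 𝓘(ℝ, ℝ) ψ x = 0 := by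
  obtain ⟨hsmooth, hwave, K, hK, hdata⟩ := hψ
  obtain ⟨ρ, hρ, hKρ⟩ := exists_spatialNorm_le_of_isCompact hK
  refine ⟨ρ, hρ, fun x hx0 hfar ↦
    hfs M a hMa ψ hsmooth hwave ρ (fun z hz0 hzρ ↦ ?_) x hx0 hfar⟩
  exact hdata z hz0 fun hzK ↦ absurd hzρ (not_lt.mpr (hKρ z hzK))

/-- **Pointwise derivative decay implies polynomial decay of the local energy**: Cor. 3.1 (31)
with `δ = 1` bounds the coordinate energy density on `{t* = τ} ∩ {r > r₊} ∩ {‖y‖ ≤ R}` by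
`C τ⁻²`, and integrating over the coordinate ball of radius `R` (finite Lebesgue measure) gives
`E_loc(τ, R) ≤ C vol(B_R) τ⁻²`, i.e. the vendored consequence `drsr_wave_polynomial_decay_kerr`
of the energy-flux estimate of Cor. 3.1. DRSR, arXiv:1402.7034, Cor. 3.1. [folklore] -/
theorem drsr_wave_polynomial_decay_kerr_of_derivative_decay
    (h : drsr_wave_derivative_decay_kerr) : drsr_wave_polynomial_decay_kerr := by
  intro _ _ M a hMa ψ hψ R
  obtain ⟨C, hC⟩ := h M a hMa ψ hψ 1 one_pos R
  refine ⟨ENNReal.ofReal (max C 0) * volume (closedBall (0 : E3) R),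
    ENNReal.mul_lt_top ENNReal.ofReal_lt_top measure_closedBall_lt_top, fun τ hτ ↦ ?_⟩
  have hτ2 : 0 ≤ τ ^ (-2 : ℝ) := Real.rpow_nonneg (by linarith) _
  calc localSliceEnergy (Kerr.exterior M a) ψ τ R
      ≤ ∫⁻ _ in closedBall (0 : E3) R, ENNReal.ofReal (max C 0 * τ ^ (-2 : ℝ)) := by
        refine setLIntegral_mono' measurableSet_closedBall fun y hy ↦ ?_
        by_cases hmem : E4.ofTimeSpace τ y ∈ Kerr.exterior M a
        · rw [indicator_of_mem (show y ∈ {y | E4.ofTimeSpace τ y ∈ Kerr.exterior M a} from hmem)]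
          refine ENNReal.ofReal_le_ofReal ?_
          calc coordEnergyDensity (Kerr.exterior M a) ψ (E4.ofTimeSpace τ y)
              ≤ C * τ ^ (-4 + 2 * (1 : ℝ)) := hC τ hτ y hmem (mem_closedBall_zero_iff.mp hy)
            _ = C * τ ^ (-2 : ℝ) := by norm_num
            _ ≤ max C 0 * τ ^ (-2 : ℝ) := mul_le_mul_of_nonneg_right (le_max_left _ _) hτ2
        · rw [indicator_of_notMem
            (show y ∉ {y | E4.ofTimeSpace τ y ∈ Kerr.exterior M a} from hmem)]
          exact zero_le
    _ = ENNReal.ofReal (max C 0 * τ ^ (-2 : ℝ)) * volume (closedBall (0 : E3) R) :=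
        setLIntegral_const _ _
    _ = ENNReal.ofReal (max C 0) * volume (closedBall (0 : E3) R) *
          ENNReal.ofReal (τ ^ (-2 : ℝ)) := by
        rw [ENNReal.ofReal_mul (le_max_right _ _)]
        ring

/-- **Pointwise derivative decay implies local energy decay**: Cor. 3.1 (31) ⟹ the vendored
`τ⁻²` local energy bound ⟹ `E_loc(τ, R) → 0` (`drsr_wave_local_energy_decay_kerr`, via
`drsr_wave_local_energy_decay_kerr_of_polynomial_decay` of `BlackHoles.lean`). DRSR,
arXiv:1402.7034, Cor. 3.1. [folklore] -/
theorem drsr_wave_local_energy_decay_kerr_of_derivative_decay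
    (h : drsr_wave_derivative_decay_kerr) : drsr_wave_local_energy_decay_kerr :=
  drsr_wave_local_energy_decay_kerr_of_polynomial_decay
    (drsr_wave_polynomial_decay_kerr_of_derivative_decay h)

/-- **Pointwise decay, qualitative form**: under Cor. 3.1 (30), an admissible wave tends to `0`
along `t* → ∞` at every fixed spatial point `y` of the slice `{r > r₊}` (take `δ = 1/2`, so that
`|ψ(τ, y)| ≤ C τ⁻¹ → 0`). Membership `(τ, y) ∈ {r > r₊}` is `y ∈ Kerr.slice a r₊`
(`Kerr.ofTimeSpace_mem_exterior_iff`). DRSR, arXiv:1402.7034, Cor. 3.1 (30). [folklore] -/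
theorem drsr_wave_pointwise_decay_kerr.tendsto_zero (h : drsr_wave_pointwise_decay_kerr)
    [Kerr.Facts] [Kerr.SliceFacts] {M a : ℝ} (hMa : Kerr.IsSubextremal M a)
    {ψ : Kerr.exterior M a → ℝ} (hψ : IsAdmissibleKerrWave M a ψ) {y : E3}
    (hy : y ∈ Kerr.slice a (Kerr.rPlus M a)) :
    Tendsto (fun τ : ℝ ↦ ψ ⟨E4.ofTimeSpace τ y, Kerr.ofTimeSpace_mem_exterior_iff.2 hy⟩)
      atTop (𝓝 0) := by
  obtain ⟨C, hC⟩ := h M a hMa ψ hψ (1 / 2) one_half_pos ‖y‖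
  have hmaj : Tendsto (fun τ : ℝ ↦ C * τ ^ (-(3 / 2 : ℝ) + 1 / 2)) atTop (𝓝 0) := by
    have h1 : Tendsto (fun τ : ℝ ↦ τ ^ (-(1 : ℝ))) atTop (𝓝 0) := tendsto_rpow_neg_atTop one_pos
    have h2 : (fun τ : ℝ ↦ C * τ ^ (-(3 / 2 : ℝ) + 1 / 2)) = fun τ ↦ C * τ ^ (-(1 : ℝ)) := by
      funext τ; norm_num
    rw [h2]
    simpa using h1.const_mul C
  rw [tendsto_zero_iff_abs_tendsto_zero]
  refine tendsto_of_tendsto_of_tendsto_of_le_of_le' tendsto_const_nhds hmaj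
    (Eventually.of_forall fun _ ↦ abs_nonneg _) ?_
  filter_upwards [eventually_ge_atTop (1 : ℝ)] with τ hτ
  exact hC τ hτ y (Kerr.ofTimeSpace_mem_exterior_iff.2 hy) le_rfl

/-- **Integrated decay, qualitative form**: if the second-order initial energy `E₂[ψ](0)` is
finite, then under Thm. 3.2 (25) the local energy `E_loc(τ, R)` is `< ε` at arbitrarily late
times, for every `ε > 0` (otherwise `E_loc ≥ ε` on some `[T, ∞)` and `∫₀^∞ E_loc dτ = ∞`).
Together with a local-in-time energy inequality this is the classical route to
`E_loc(τ, R) → 0`; here only the statement-level consequence is recorded. DRSR,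
arXiv:1402.7034, Thm. 3.2 (25). [folklore] -/
theorem drsr_wave_integrated_decay_kerr.frequently_lt (h : drsr_wave_integrated_decay_kerr)
    [Kerr.Facts] [Kerr.SliceFacts] {M a : ℝ} (hMa : Kerr.IsSubextremal M a)
    {ψ : Kerr.exterior M a → ℝ} (hψ : IsAdmissibleKerrWave M a ψ)
    (hE : sliceSobolevEnergy (Kerr.exterior M a) ψ 0 2 0 univ < ⊤) (R : ℝ) {ε : ℝ≥0∞}
    (hε : 0 < ε) :
    ∃ᶠ τ in atTop, localSliceEnergy (Kerr.exterior M a) ψ τ R < ε := by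
  obtain ⟨C, hC, hb⟩ := h M a hMa R
  have hfin : ∫⁻ τ in Ioi (0 : ℝ), localSliceEnergy (Kerr.exterior M a) ψ τ R < ⊤ :=
    (hb ψ hψ).trans_lt (ENNReal.mul_lt_top hC hE)
  rw [frequently_atTop]
  intro T
  by_contra hcon
  push Not at hcon
  -- `E_loc ≥ ε` on `[max T 1, ∞)`: the integral over `[max T 1, max T 1 + n]` is `≥ n ε`.
  set T₁ : ℝ := max T 1 with hT₁
  have hT₁pos : 0 < T₁ := lt_of_lt_of_le one_pos (le_max_right _ _)
  have hlow : ∀ n : ℕ, (n : ℝ≥0∞) * ε ≤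
      ∫⁻ τ in Ioi (0 : ℝ), localSliceEnergy (Kerr.exterior M a) ψ τ R := by
    intro n
    calc (n : ℝ≥0∞) * ε = ε * volume (Icc T₁ (T₁ + n)) := by
          rw [Real.volume_Icc, add_sub_cancel_left, ENNReal.ofReal_natCast, mul_comm]
      _ = ∫⁻ _ in Icc T₁ (T₁ + n), ε := (setLIntegral_const _ _).symm
      _ ≤ ∫⁻ τ in Icc T₁ (T₁ + n), localSliceEnergy (Kerr.exterior M a) ψ τ R := by
          refine setLIntegral_mono' measurableSet_Icc fun τ hτ ↦ ?_
          exact hcon τ ((le_max_left _ _).trans hτ.1)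
      _ ≤ ∫⁻ τ in Ioi (0 : ℝ), localSliceEnergy (Kerr.exterior M a) ψ τ R :=
          lintegral_mono_set fun τ hτ ↦ hT₁pos.trans_le hτ.1
  -- but `n ε → ∞`
  have htop : Tendsto (fun n : ℕ ↦ (n : ℝ≥0∞) * ε) atTop (𝓝 ⊤) := by
    have := ENNReal.Tendsto.mul_const ENNReal.tendsto_nat_nhds_top (b := ε)
      (Or.inl ENNReal.top_ne_zero)
    rwa [ENNReal.top_mul hε.ne'] at this
  have hle : (⊤ : ℝ≥0∞) ≤ ∫⁻ τ in Ioi (0 : ℝ), localSliceEnergy (Kerr.exterior M a) ψ τ R :=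
    le_of_tendsto' htop hlow
  exact (lt_irrefl _) ((top_le_iff.mp hle) ▸ hfin)

end Literature.Geometry.Lorentzian

end
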